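import Summits.BirchSwinnertonDyer.BirchSwinnertonDyer.Theses.KatoDescentPotSupersingular
import Summits.BirchSwinnertonDyer.BirchSwinnertonDyer.Theses.KatoDescentTamePotSupersingular
import Summits.BirchSwinnertonDyer.BirchSwinnertonDyer.Theorems.PoitouTateSelmerStructureDualityConjHolds
import HarnessLib

set_option linter.dupNamespace false -- `…BirchSwinnertonDyer.BirchSwinnertonDyer…` is the cell's nested layout (D-0017)
set_option autoImplicit false

/-!
# Item 23036 `HeldPoitouTateSelmerDuality` (routes `KatoDescentPotSupersingular`, `KatoDescentTamePotSupersingular`, support 503) —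
# Poitou–Tate duality for Selmer structures, conjugation-compatible currency, every number field — PROVED BY NAME
# (LADDER-BSD D-0154 (2), INPUTS TRANCHE #3b)

Seat `bsd-inputs-honda-p1` (gen 6, idle INPUTS prover of the desk `pub/bsd-wall/bsd-inputs`), `--workitem` stmt-BirchSwinnertonDyer-23036.
THEOREMS ONLY (no definition, no named fact, no `sorry`).

The item is the named published fact `∀ K, Literature.NumberTheory.GaloisCohomology.poitouTate_selmerStructure_duality_conj K`, a THEOREM OF
THE TREE for THE canonical family: `InputsPoitouTateSelmer.poitouTate_selmerStructure_duality_conj_holds (K)` (route-free module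
`Theorems.PoitouTateSelmerStructureDualityConjHolds`; bsd-jet `…_conj_of_canonical_numberField` ∘ bsd-schneider `unramifiedOrthogonal_of_isPerfect_allLevels`,
`selmerComplement_canonical_holds` — door-c4 g18, p626891). The two route docstrings name exactly this refinement
(«⟸ `poitouTate_selmerStructure_duality_conj_of_canonical_numberField K hUO hSC`»). This leaf file records it against the two route
declarations (one item by dedup) by `unfold; exact fun K _ _ => … K`.

Honest framing: UNCONDITIONAL (classical Poitou–Tate duality, kernel-checked elsewhere in the tree). Closing item 23036 discharges the HELD
PT binder of the two Kato-descent routes AS TYPED only; their cruxes are not proved; no summit statement is proved; the Birch–Swinnerton-Dyer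
conjecture is NOT proved by any of this. References: [MilneADT2006] Ch. I, Thm. 4.10 (b); [Howard2004HeegnerKolyvagin] Thm. 2.1.11;
[MazurRubin2004] Thm. 2.3.4.
-/

namespace Summit.BirchSwinnertonDyer.BirchSwinnertonDyer.Theorems.InputsPoitouTateSelmer

open Literature.NumberTheory.GaloisCohomology

/-- **Item 23036 on route `KatoDescentPotSupersingular` — `HeldPoitouTateSelmerDuality` PROVED (by name):**
`∀ K, poitouTate_selmerStructure_duality_conj K` from `poitouTate_selmerStructure_duality_conj_holds`. Unconditional; closes item 23036;
BSD is not proved by this. [cite: MilneADT2006, Ch. I, Thm. 4.10 (b) (proof, p. 58), Cor. 2.3, Thm. 2.6]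
[cite: Howard2004HeegnerKolyvagin, Thm. 2.1.11 (arXiv:1202.6340 p. 6)] -/
theorem katoDescentPotSupersingular_heldPoitouTateSelmerDuality_proof :
    Summit.BirchSwinnertonDyer.BirchSwinnertonDyer.Theses.KatoDescentPotSupersingular.HeldPoitouTateSelmerDuality := by
  unfold Summit.BirchSwinnertonDyer.BirchSwinnertonDyer.Theses.KatoDescentPotSupersingular.HeldPoitouTateSelmerDuality
  exact fun K _ _ => poitouTate_selmerStructure_duality_conj_holds K

/-- **Item 23036 on route `KatoDescentTamePotSupersingular` — the same item (one item by dedup), `HeldPoitouTateSelmerDuality` PROVED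
(by name).** Unconditional; BSD is not proved by this. [cite: MilneADT2006, Ch. I, Thm. 4.10 (b) (proof, p. 58)]
[cite: Howard2004HeegnerKolyvagin, Thm. 2.1.11 (arXiv:1202.6340 p. 6)] -/
theorem katoDescentTamePotSupersingular_heldPoitouTateSelmerDuality_proof :
    Summit.BirchSwinnertonDyer.BirchSwinnertonDyer.Theses.KatoDescentTamePotSupersingular.HeldPoitouTateSelmerDuality := by
  unfold Summit.BirchSwinnertonDyer.BirchSwinnertonDyer.Theses.KatoDescentTamePotSupersingular.HeldPoitouTateSelmerDuality
  exact fun K _ _ => poitouTate_selmerStructure_duality_conj_holds K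

end Summit.BirchSwinnertonDyer.BirchSwinnertonDyer.Theorems.InputsPoitouTateSelmer
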